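/- EXTRA WIDTH seat `ym-line-cbag-p1-w4` (prover-ym-line-cbag-p1-w4-g13-0), LINE 7b `VolumeComparison` of route `GlueballBandRecursion`,
item ⟨stmt-QuantumFields-22957⟩ (`--supports`, helper; it closes nothing).  Sequel of `…SupportExpansion.lean`: the closedness-aware
TRUNCATION of the cluster expansion regrouped by support, with the rate-tracking Kotecký–Preiss tail.  Generic plaquette system; def-free. -/
import Summits.QuantumFields.YangMills.Theorems.GlueballBandRecursionSupportExpansion
import Summits.QuantumFields.YangMills.Theorems.IR.StrongCouplingRateTail

/-!
# Route `GlueballBandRecursion`, LINE 7b: truncation of `log Z` by support with the rate-tracking tail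

For a regular plaquette system `S : PlaqSystem d G ι` on `ν = zdHaar d G`, `log Z(W)(z) = Σ_{A ⊆ W} ψ(A)(z)` with the support sums
`ψ(A) = Σ_{𝒞 ⊆ 𝒫(A), ⋃𝒞 = A} Φ^T(𝒞)` (`Support.pertLogZ_eq_sum_support`).  Here:

* `norm_pertLogZ_sub_sum_support_le_rate` (**closedness-aware truncation by support**): on the rate-`τ` disc `‖z‖M ≤ 1`,
  `e^{1+τ}(2M‖z‖)(D+1)² ≤ 1/2` (`τ ≥ 0`; `τ = 1 + log(r_ρ/‖z‖)` is admissible up to the radius `r_ρ` of module XII, giving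
  `e^{−τ m} = (‖z‖/(e r_ρ))^m`), if every `S.Adj`-connected support class `A ⊆ W` with `2 ≤ #A` outside a kept family `P` either
  VANISHES (`ψ(A) = 0` — e.g. `A` is not closed: `Support.support_sum_eq_zero_of_partZ_eq_mul` + free-bond Haar averaging) or is
  LARGE (`m ≤ #A` — e.g. `A` is closed and wide: the torus slab count), then
  `‖log Z(W)(z) − Σ_{A ⊆ W, #A = 1 ∨ P A} ψ(A)(z)‖ ≤ #W · e^{−τ m}`:
  empty and disconnected classes vanish (`Support.support_sum_empty`, `support_sum_eq_zero_of_not_isRConnected`), and every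
  remaining class consists of families with `Σ_{Y ∈ 𝒞} #Y ≥ #⋃𝒞 ≥ m`, inside the tree's rate-tracking tail
  `Cruxes.IR.StrongCouplingRate.sum_norm_truncatedWeight_large_le_rate`.

Use (LEAD ym-line-cbag-p1 g29's jet stub, w2 g23's remark R2): for `boxSystem ρ ![N,N,N,t]`, `P A` = «closed, connected, every
spatial extent ≤ N − 2», `m = 4(N−1)`: the kept sum is `#labels · log Z({p})` plus `N³ ×` an `N`-independent rooted sum, so the thermal
free-energy density of two spatial volumes differs by `O((‖z‖/(e r_ρ))^{4(N−1)})` on the whole disc — no cumulants, no Taylor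
coefficients, no Schwarz lemma.

HONEST FRAMING.  Bookkeeping on top of the tree's Kotecký–Preiss layer; nothing here proves the volume comparison, item 22957, the
RECORD rung `ColdDoublingRecursionStrongCoupling`, or the Yang–Mills mass gap / the summit `YangMills`.
-/

set_option autoImplicit false

noncomputable section

open MeasureTheory Finset Filter Topology
open Literature.Probability.LatticeModels
open Literature.MathematicalPhysics.QuantumFieldTheory

namespace Summit.QuantumFields.YangMills.Theorems.GlueballBandRecursion.Support

variable {d : ℕ} {G : Type*} [Group G] [TopologicalSpace G] [IsTopologicalGroup G] [CompactSpace G]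
  [MeasurableSpace G] [BorelSpace G] {ι : Type*} [DecidableEq ι] {S : PlaqSystem d G ι} {M : ℝ} {D : ℕ}


/-- A family of polymers with union `A` has total size at least `#A`. -/
theorem card_le_sum_card_of_biUnion_eq {𝒞 : Finset (Finset ι)} {A : Finset ι} (h : 𝒞.biUnion id = A) :
    (A.card : ℝ) ≤ ∑ Y ∈ 𝒞, (Y.card : ℝ) := by
  rw [← h]
  exact_mod_cast Finset.card_biUnion_le

/-- **Closedness-aware truncation of the cluster expansion by support.**  On the rate-`τ` disc `‖z‖M ≤ 1`,
`e^{1+τ}(2M‖z‖)(D+1)² ≤ 1/2` (`τ ≥ 0`): let `P` be any (kept) family of label sets and `m : ℕ`, and suppose every `S.Adj`-connected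
`A ⊆ W` with `2 ≤ #A` outside `P` either has vanishing support sum (e.g. it is NOT CLOSED: §3 with free-bond Haar averaging) or has
`m ≤ #A` (e.g. it is closed and wide: the torus slab count).  Then
`‖log Z(W)(z) − Σ_{A ⊆ W, #A = 1 ∨ P A} ψ(A)(z)‖ ≤ #W · e^{−τ m}`:
the classes of the empty set and of disconnected sets vanish (§4), and every remaining class consists of families `𝒞` with
`Σ_{Y ∈ 𝒞} #Y ≥ #⋃𝒞 ≥ m`, inside the tree's rate-tracking tail `sum_norm_truncatedWeight_large_le_rate`. -/
theorem norm_pertLogZ_sub_sum_support_le_rate [Fintype ι] (hR : S.Regular M D) {z : ℂ} (hzM : ‖z‖ * M ≤ 1) {τ : ℝ} (hτ : 0 ≤ τ)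
    (hsmall : Real.exp (1 + τ) * (2 * M * ‖z‖) * ((D : ℝ) + 1) ^ 2 ≤ 1 / 2) (W : Finset ι)
    (P : Finset ι → Prop) [DecidablePred P] (m : ℕ)
    (hP : ∀ A ⊆ W, 2 ≤ A.card → IsRConnected S.Adj A → ¬ P A →
      (∑ 𝒞 ∈ (rconnSubsets S.Adj A).powerset with 𝒞.biUnion id = A,
          truncatedWeight (GeomInc S.Adj) (connActivity S.Adj (zdHaar d G) (S.weight z)) 𝒞) = 0 ∨ m ≤ A.card) :
    ‖pertLogZ (zdHaar d G) (S.weight z) S.Adj W -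
        ∑ A ∈ W.powerset with (A.card = 1 ∨ P A), ∑ 𝒞 ∈ (rconnSubsets S.Adj A).powerset with 𝒞.biUnion id = A,
          truncatedWeight (GeomInc S.Adj) (connActivity S.Adj (zdHaar d G) (S.weight z)) 𝒞‖ ≤
      W.card * Real.exp (-(τ * m)) := by
  classical
  set Φ : Finset (Finset ι) → ℂ :=
    truncatedWeight (GeomInc S.Adj) (connActivity S.Adj (zdHaar d G) (S.weight z)) with hΦ
  set fib : Finset ι → Finset (Finset (Finset ι)) := fun A =>
    (rconnSubsets S.Adj A).powerset.filter fun 𝒞 => 𝒞.biUnion id = A with hfib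
  set ψ : Finset ι → ℂ := fun A => ∑ 𝒞 ∈ fib A, Φ 𝒞 with hψ
  have hε : 0 ≤ 2 * M * ‖z‖ := by have := hR.pos; positivity
  have hsmall1 := smallness_one_of_rate (D := D) hε hτ hsmall
  -- split the support expansion into kept and discarded classes
  have hsplit : pertLogZ (zdHaar d G) (S.weight z) S.Adj W - ∑ A ∈ W.powerset with (A.card = 1 ∨ P A), ψ A =
      ∑ A ∈ W.powerset with ¬ (A.card = 1 ∨ P A), ψ A := by
    rw [pertLogZ_eq_sum_support S W z, ← Finset.sum_filter_add_sum_filter_not W.powerset (fun A => A.card = 1 ∨ P A)]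
    exact add_sub_cancel_left _ _
  -- the discarded classes with a nonzero sum are connected, of size `≥ 2`, outside `P`, hence large
  set Bad : Finset (Finset ι) := (W.powerset.filter fun A => ¬ (A.card = 1 ∨ P A)).filter fun A => ψ A ≠ 0 with hBad
  have hBad_large : ∀ A ∈ Bad, (m : ℝ) ≤ A.card := by
    intro A hAB
    obtain ⟨hA1, hψA⟩ := Finset.mem_filter.1 hAB
    obtain ⟨hAW, hnot⟩ := Finset.mem_filter.1 hA1
    have hAW' : A ⊆ W := Finset.mem_powerset.1 hAW
    have hAne : A.Nonempty := by
      rw [Finset.nonempty_iff_ne_empty]; rintro rfl; exact hψA (support_sum_empty z)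
    have hconn : IsRConnected S.Adj A := by
      by_contra h; exact hψA (support_sum_eq_zero_of_not_isRConnected hR hzM hsmall1 hAne h)
    have h2 : 2 ≤ A.card := by
      have h1 : A.card ≠ 1 := fun h => hnot (Or.inl h)
      have h0 : A.card ≠ 0 := by rw [Finset.card_ne_zero]; exact hAne
      omega
    rcases hP A hAW' h2 hconn (fun h => hnot (Or.inr h)) with h | h
    · exact absurd h hψA
    · exact_mod_cast h
  -- drop the vanishing classes
  have hdrop : ∑ A ∈ W.powerset with ¬ (A.card = 1 ∨ P A), ψ A = ∑ A ∈ Bad, ψ A := by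
    rw [hBad, Finset.sum_filter_ne_zero]
  -- the families of the large classes, as a subfamily of the tail
  set T : Finset (Finset (Finset ι)) := (rconnSubsets S.Adj W).powerset.filter fun 𝒞 => 𝒞.biUnion id ∈ Bad with hT
  have hmapsT : ∀ 𝒞 ∈ T, 𝒞.biUnion id ∈ Bad := fun 𝒞 h𝒞 => (Finset.mem_filter.1 h𝒞).2
  have hfibT : ∀ A ∈ Bad, T.filter (fun 𝒞 => 𝒞.biUnion id = A) = fib A := by
    intro A hAB
    have hAW : A ⊆ W := Finset.mem_powerset.1 (Finset.mem_filter.1 (Finset.mem_filter.1 hAB).1).1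
    rw [hfib]
    simp only
    rw [← filter_powerset_rconnSubsets_biUnion_eq S.Adj hAW, hT, Finset.filter_filter]
    refine Finset.filter_congr fun 𝒞 _ => ⟨fun h => h.2, fun h => ⟨h ▸ hAB, h⟩⟩
  have hsumT : ∑ A ∈ Bad, ∑ 𝒞 ∈ fib A, ‖Φ 𝒞‖ = ∑ 𝒞 ∈ T, ‖Φ 𝒞‖ := by
    rw [← Finset.sum_fiberwise_of_maps_to (g := fun 𝒞 => 𝒞.biUnion id) (f := fun 𝒞 => ‖Φ 𝒞‖) hmapsT]
    exact Finset.sum_congr rfl fun A hA => by rw [hfibT A hA]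
  have hTsub : T ⊆ (rconnSubsets S.Adj W).powerset.filter fun 𝒞 => (m : ℝ) ≤ ∑ Y ∈ 𝒞, (Y.card : ℝ) := by
    intro 𝒞 h𝒞
    obtain ⟨h𝒞W, h𝒞B⟩ := Finset.mem_filter.1 h𝒞
    exact Finset.mem_filter.2 ⟨h𝒞W, (hBad_large _ h𝒞B).trans (card_le_sum_card_of_biUnion_eq rfl)⟩
  have htail := Summit.QuantumFields.YangMills.Cruxes.IR.StrongCouplingRate.sum_norm_truncatedWeight_large_le_rate
    hR hzM hτ hsmall W m
  calc ‖pertLogZ (zdHaar d G) (S.weight z) S.Adj W - ∑ A ∈ W.powerset with (A.card = 1 ∨ P A), ψ A‖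
      = ‖∑ A ∈ Bad, ψ A‖ := by rw [hsplit, hdrop]
    _ ≤ ∑ A ∈ Bad, ‖ψ A‖ := norm_sum_le _ _
    _ ≤ ∑ A ∈ Bad, ∑ 𝒞 ∈ fib A, ‖Φ 𝒞‖ := Finset.sum_le_sum fun A _ => norm_sum_le _ _
    _ = ∑ 𝒞 ∈ T, ‖Φ 𝒞‖ := hsumT
    _ ≤ ∑ 𝒞 ∈ (rconnSubsets S.Adj W).powerset with (m : ℝ) ≤ ∑ Y ∈ 𝒞, (Y.card : ℝ), ‖Φ 𝒞‖ :=
        Finset.sum_le_sum_of_subset_of_nonneg hTsub fun _ _ _ => norm_nonneg _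
    _ ≤ W.card * Real.exp (-(τ * m)) := htail


end Summit.QuantumFields.YangMills.Theorems.GlueballBandRecursion.Support

end
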